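import Summits.CriticalPhenomena.Ising3DConformalLimit.Theses.PrimaryAtInfinity
import Literature.Probability.LatticeModels.CriticalUrsellFourSign

/-! BC5 special case (sorry-free) for crux `FirstMultipoleIdentity` (stmt-CriticalPhenomena-5352): the crux's
conclusion at every EVEN `n` (odd level `n + 1`, where `S (n+1) ≡ 0` for any normalised pointwise limit of
`criticalCorr 3`, by `criticalCorr_eq_zero_of_odd`), with `A₀ = 0`, `A₁ = 0`. Shows the definitions compute and the
crux is inhabited-in-kind at the trivial levels; the informative levels are odd `n ≥ 3`. -/

open scoped BigOperators Topology
open Filter Set MeasureTheory Literature.Probability.LatticeModels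
open Summit.CriticalPhenomena.Ising3DConformalLimit.Theses.PrimaryAtInfinity (FirstMultipoleIdentity)

namespace Summit.CriticalPhenomena.Ising3DConformalLimit.Cruxes.FirstMultipoleIdentity.Birth

/-- Odd-order pointwise limits of `criticalCorr 3` vanish everywhere (on `NonCoincident` as limits of the zero
function — `criticalCorr_eq_zero_of_odd`, `m*(β_c) = 0` — and off it by the normalisation). [folklore] -/
theorem limit_odd_eq_zero {ρ : ℝ → ℝ} {S : CorrFamily 3}
    (hlim : HasPointwiseScalingLimit (criticalCorr 3) ρ S)
    (hnorm : ∀ n z, z ∉ NonCoincident 3 n → S n z = 0) {m : ℕ} (hm : Odd m)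
    (z : Fin m → EuclideanSpace ℝ (Fin 3)) : S m z = 0 := by
  by_cases hz : z ∈ NonCoincident 3 m
  · have h1 : Tendsto (fun δ => rescaledCorrelator (criticalCorr 3) ρ m δ z) (𝓝[>] (0:ℝ)) (𝓝 (S m z)) :=
      (hlim m).tendsto_at hz
    have h0 : (fun δ => rescaledCorrelator (criticalCorr 3) ρ m δ z) = fun _ => (0:ℝ) := by
      funext δ
      rw [rescaledCorrelator_apply, criticalCorr_eq_zero_of_odd (by norm_num) hm, mul_zero]
    rw [h0] at h1
    exact (tendsto_nhds_unique tendsto_const_nhds h1).symm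
  · exact hnorm m z hz

/-- **BC5 special case.** The conclusion of `FirstMultipoleIdentity` at every even `n`, sorry-free. [folklore] -/
theorem firstMultipoleIdentity_evenLevel :
    ∀ (ρ : ℝ → ℝ) (S : CorrFamily 3) (c Δ : ℝ), (∀ δ ∈ Set.Ioc (0:ℝ) 1, 0 < ρ δ) →
      HasPointwiseScalingLimit (criticalCorr 3) ρ S → (∀ n z, z ∉ NonCoincident 3 n → S n z = 0) →
      0 < c → (∀ a b : EuclideanSpace ℝ (Fin 3), a ≠ b → S 2 ![a, b] = c * ‖a - b‖ ^ (-(2 * Δ))) →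
      ∀ n : ℕ, Even n →
      ∃ (A₀ : (Fin n → EuclideanSpace ℝ (Fin 3)) → ℝ)
        (A₁ : (Fin n → EuclideanSpace ℝ (Fin 3)) → EuclideanSpace ℝ (Fin 3)),
        TendstoLocallyUniformlyOn
          (fun (y : EuclideanSpace ℝ (Fin 3)) (x : (Fin n → EuclideanSpace ℝ (Fin 3))) =>
            ‖y‖ ^ (2 * Δ + 1) * S (n + 1) (Fin.snoc x y) - ‖y‖ * A₀ x - inner ℝ (A₁ x) (‖y‖⁻¹ • y))
          0 (cocompact (EuclideanSpace ℝ (Fin 3))) (NonCoincident 3 n) ∧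
        ∀ (b : EuclideanSpace ℝ (Fin 3)) (φ : (Fin n → EuclideanSpace ℝ (Fin 3)) → ℝ),
          ContDiff ℝ ((⊤ : ℕ∞) : WithTop ℕ∞) φ → HasCompactSupport φ → tsupport φ ⊆ NonCoincident 3 n →
          ∫ x, inner ℝ (A₁ x) b * φ x =
            ∫ x, A₀ x * ((2 * Δ - 6) * (∑ i, inner ℝ b (x i)) * φ x
              + fderiv ℝ φ x (fun i => ‖x i‖ ^ 2 • b - (2 * inner ℝ b (x i)) • x i)) := by
  intro ρ S c Δ hρ hlim hnorm hc h2 n hn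
  have hS : ∀ w, S (n + 1) w = 0 := fun w => limit_odd_eq_zero hlim hnorm hn.add_one w
  refine ⟨0, 0, ?_, ?_⟩
  · have hF : (fun (y : EuclideanSpace ℝ (Fin 3)) (x : (Fin n → EuclideanSpace ℝ (Fin 3))) =>
        ‖y‖ ^ (2 * Δ + 1) * S (n + 1) (Fin.snoc x y) - ‖y‖ * (0 : (Fin n → EuclideanSpace ℝ (Fin 3)) → ℝ) x
          - inner ℝ ((0 : (Fin n → EuclideanSpace ℝ (Fin 3)) → EuclideanSpace ℝ (Fin 3)) x) (‖y‖⁻¹ • y))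
        = fun _ _ => (0 : ℝ) := by
      funext y x
      simp [hS]
    rw [hF]
    refine TendstoUniformlyOn.tendstoLocallyUniformlyOn ?_
    refine Metric.tendstoUniformlyOn_iff.2 fun ε hε => Filter.Eventually.of_forall fun y x _ => ?_
    simpa using hε
  · intro b φ _ _ _
    simp

end Summit.CriticalPhenomena.Ising3DConformalLimit.Cruxes.FirstMultipoleIdentity.Birth
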